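import Mathlib.LinearAlgebra.Matrix.GeneralLinearGroup.Card
import Mathlib.Algebra.Field.ZMod
import Mathlib.GroupTheory.Perm.Fin
import HarnessLib

/-!
# The order of the symmetry group of `3 × 3` matrix multiplication schemes over `ℤ₂` (HKS 2021, §5)

Topic `Literature/Computability/AlgebraicComplexity`; a kernel-checked count behind the symmetry
group used for `⟨3,3,3⟩`-schemes over `ℤ₂` in `FlipGraphSymmetry.lean` / `FlipGraphEquivariance.lean`
(the sandwiches `(U, V, W) ∈ GL₃(K)³` and the six permutations/transpositions of the factors).
Sources: M. J. H. Heule, M. Kauers, M. Seidl, *New ways to multiply `3 × 3`-matrices*, J. Symbolic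
Comput. 104 (2021), §5: "even for `K = ℤ₂`, the group `G` has `168³ · 6 = 28 449 792` elements";
M. Kauers, J. Moosbauer, *A Normal Form for Matrix Multiplication Schemes*, CAI 2022, p. 5: "already
for `n = 3` the symmetry group over `ℤ₂` has a size of `23! · 6 · 4741632`" (the group
`S_r × S₃ ⋉ GL(K,n)³` acting on `r`-tuples, `r = 23`). Everything here is PROVED (Mathlib's
`Matrix.card_GL_field`: `|GL_n(𝔽_q)| = ∏_{i<n} (qⁿ − qⁱ)`); no named facts, no definitions.

* `card_GL_fin_three_zmod_two` — `|GL₃(ℤ₂)| = (8−1)(8−2)(8−4) = 168`;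
* `heuleKauersSeidl2021_symmetry_group_card` — `|GL₃(ℤ₂)³ × S₃| = 168³ · 6 = 28 449 792` (the
  underlying set of the semidirect product `S₃ ⋉ GL₃(ℤ₂)³` is the product);
* `kauersMoosbauer2022_normalForm_group_card` — `|S₂₃ × (S₃ × GL₃(ℤ₂)³)| = 23! · 6 · 4741632`;
* `card_GL_fin_two_zmod_two` — the same formula at `n = 2`: `|GL₂(ℤ₂)| = (4−1)(4−2) = 6`, whence
  the group for `⟨2,2,2⟩`-schemes over `ℤ₂` has `6³ · 6 = 1296` elements (`card_symmetry_group_two`).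

## References

* M. J. H. Heule, M. Kauers, M. Seidl, *New ways to multiply `3 × 3`-matrices*, J. Symbolic Comput.
  104 (2021) 899–916, arXiv:1905.10192, §5. [HeuleKauersSeidl2021]
* M. Kauers, J. Moosbauer, *A Normal Form for Matrix Multiplication Schemes*, in: Algebraic
  Informatics (CAI 2022), LNCS, Springer, 149–160, doi:10.1007/978-3-031-19685-0_11, p. 5.
  [KauersMoosbauer2022NormalForm]
-/

namespace Literature.Computability.AlgebraicComplexity

open Matrix

/-- **`|GL₃(ℤ₂)| = 168`** (`= (2³−1)(2³−2)(2³−2²)`), the order of the group of base changes of one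
factor of a `3 × 3` scheme over `ℤ₂`. [cite: HeuleKauersSeidl2021, §5 ("`168³ · 6`")] -/
theorem card_GL_fin_three_zmod_two : Nat.card (GL (Fin 3) (ZMod 2)) = 168 := by
  have h := Matrix.card_GL_field (𝔽 := ZMod 2) 3
  rw [ZMod.card, Fin.prod_univ_three] at h
  exact h

/-- **HKS §5: "even for `K = ℤ₂`, the group `G` has `168³ · 6 = 28 449 792` elements"** — `G` the
symmetry group of `3 × 3` matrix multiplication schemes, generated by the sandwiches
`(U, V, W) ∈ GL₃(ℤ₂)³` and the `6` permutations/transpositions of the three factors; as a set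
`G = GL₃(ℤ₂)³ × S₃`. [cite: HeuleKauersSeidl2021, §5] -/
theorem heuleKauersSeidl2021_symmetry_group_card :
    Nat.card ((GL (Fin 3) (ZMod 2) × GL (Fin 3) (ZMod 2) × GL (Fin 3) (ZMod 2)) ×
      Equiv.Perm (Fin 3)) = 28449792 := by
  rw [Nat.card_prod, Nat.card_prod, Nat.card_prod, card_GL_fin_three_zmod_two,
    Nat.card_eq_fintype_card (α := Equiv.Perm (Fin 3)), Fintype.card_perm, Fintype.card_fin]
  decide

/-- **KM (normal form), p. 5: "already for `n = 3` the symmetry group over `ℤ₂` has a size of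
`23! · 6 · 4741632`"** — the group `S_r × S₃ ⋉ GL(K, n)³` acting on `r`-tuples of rank-one tensors,
`r = 23`, `n = 3`, `K = ℤ₂` (`4741632 = 168³`).
[cite: KauersMoosbauer2022NormalForm, p. 5] -/
theorem kauersMoosbauer2022_normalForm_group_card :
    Nat.card (Equiv.Perm (Fin 23) × (Equiv.Perm (Fin 3) ×
      (GL (Fin 3) (ZMod 2) × GL (Fin 3) (ZMod 2) × GL (Fin 3) (ZMod 2)))) =
      Nat.factorial 23 * 6 * 4741632 := by
  rw [Nat.card_prod, Nat.card_prod, Nat.card_prod, Nat.card_prod, card_GL_fin_three_zmod_two,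
    Nat.card_eq_fintype_card (α := Equiv.Perm (Fin 23)), Fintype.card_perm, Fintype.card_fin,
    Nat.card_eq_fintype_card (α := Equiv.Perm (Fin 3)), Fintype.card_perm, Fintype.card_fin]
  decide

/-- The same count one size down: **`|GL₂(ℤ₂)| = 6`** (`= (2²−1)(2²−2)`).
[cite: HeuleKauersSeidl2021, §5 (the formula `|GL_n(ℤ₂)|³ · 6` at `n = 2`)] -/
theorem card_GL_fin_two_zmod_two : Nat.card (GL (Fin 2) (ZMod 2)) = 6 := by
  have h := Matrix.card_GL_field (𝔽 := ZMod 2) 2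
  rw [ZMod.card, Fin.prod_univ_two] at h
  exact h

/-- Hence the symmetry group of `2 × 2` schemes over `ℤ₂`, `GL₂(ℤ₂)³ × S₃` as a set, has
`6³ · 6 = 1296` elements (the group of the `⟨2,2,2⟩` orbit counts of KM 2023, §4).
[cite: HeuleKauersSeidl2021, §5 (the formula `|GL_n(ℤ₂)|³ · 6` at `n = 2`)] -/
theorem card_symmetry_group_two :
    Nat.card ((GL (Fin 2) (ZMod 2) × GL (Fin 2) (ZMod 2) × GL (Fin 2) (ZMod 2)) ×
      Equiv.Perm (Fin 3)) = 1296 := by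
  rw [Nat.card_prod, Nat.card_prod, Nat.card_prod, card_GL_fin_two_zmod_two,
    Nat.card_eq_fintype_card (α := Equiv.Perm (Fin 3)), Fintype.card_perm, Fintype.card_fin]
  decide

end Literature.Computability.AlgebraicComplexity
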